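import Summits.Parity.BatemanHorn.Theorems.AlmostPrimeZerosLinearCappedRepulsionCappedEulerData

/-!
# The twisted capped Euler product, I: generic character (stub `stub_apTwistedEulerDataCore`)

Line `smooth-rough-lattice-acquisition` of crux stmt-Parity-11291
(`Summit.Parity.BatemanHorn.Theses.AlmostPrimeZeros.SystemZeroRepulsion`), class `linₐ`; helper
of `AlmostPrimeZerosSystemZeroRepulsionApTwistedEulerData.lean` (stub `stub_apTwistedEulerData`).

For a Dirichlet character `χ mod q`, `s(n) = Σ_{p^v ∥ n} min(v, 2)` and the multiplicative
coefficients `a(n) = χ(n) z^{s(n)}` this file proves, with `w_p = χ(p) p^{-s}`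
(`‖w_p‖ ≤ p^{-σ}`) and Selberg's factors `E(w, z) = (1 + z w + z² w²/(1 − w))·exp(z Log(1 − w))`:

* `G(s) = ∏_p E(w_p, z)` converges locally uniformly on `σ > σ₀ > 1/2` and is holomorphic on
  `σ > 1/2` (`hasProdLocallyUniformlyOn_factor`, `differentiableOn_tprod_factor`);
* `Σ a(n) n^{-s} = exp(z Σ_p −Log(1 − w_p)) · G(s)` on `σ > 1` (`hasProd_LSeries`,
  `LSeries_eq`);
* `‖G(s)‖ ≤ exp(30 S (1+R)^{3/2})` for `σ > 4/5`, `‖z‖ ≤ R`, `S = Σ_p p^{-6/5}`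
  (`norm_tprod_factor_le`), and the majorant
  `Σ ‖a(n)‖ n^{-σ} ≤ e^{(30 S + 1)(1+R)^{3/2}} (σ − 1)^{-R}`, `1 < σ ≤ 2` (`tsum_norm_term_le`,
  by comparison with the untwisted series);
* **`stub_apTwistedEulerDataCore`**: all of the above with the one constant `b = 30 S + 1`.

A mechanical adaptation of `AlmostPrimeZerosLinearCappedRepulsionCappedEulerData.lean` (the case
`χ = 1`, `q = 1`) through the abstract-`w` estimates
`SelbergDelangeCapped.norm_capFactor_sub_one_le`, `norm_capFactor_le` and Mathlib's
`DirichletCharacter.summable_neg_log_one_sub_mul_prime_cpow`.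
Theorem-only file (no definitions). References: H. L. Montgomery, R. C. Vaughan,
*Multiplicative Number Theory I*, CUP 2007, §7.4, §11.3; G. Tenenbaum, *Introduction to analytic
and probabilistic number theory*, 3rd ed., II.5.
-/

noncomputable section

open Complex LSeries Filter Topology Finset
open Literature.NumberTheory.LFunctions Literature.NumberTheory.LFunctions.SelbergDelangeCapped
open Summit.Parity.BatemanHorn.Cruxes.LinearCappedRepulsion.JensenStieltjesMajorant

namespace Summit.Parity.BatemanHorn.Cruxes.SystemZeroRepulsion.NearFar

namespace ApTwistedEuler

variable {q : ℕ} (χ : DirichletCharacter ℂ q)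

/-! ### The twist `w_p = χ(p) p^{-s}` -/

/-- `‖χ(p) p^{-s}‖ ≤ p^{-σ}`. -/
theorem norm_twist_le (p : Nat.Primes) (s : ℂ) :
    ‖χ p * (p : ℂ) ^ (-s)‖ ≤ ((p : ℕ) : ℝ) ^ (-s.re) := by
  rw [norm_mul, ← SatheSelberg.norm_primes_cpow_neg]
  exact mul_le_of_le_one_left (norm_nonneg _) (χ.norm_le_one _)

/-- `‖χ(p) p^{-s}‖ ≤ 3/4` for `σ ≥ 1/2`. -/
theorem norm_twist_le_three_div_four (p : Nat.Primes) {s : ℂ} (hs : 1 / 2 ≤ s.re) :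
    ‖χ p * (p : ℂ) ^ (-s)‖ ≤ 3 / 4 := by
  have h := CappedEuler.norm_primes_cpow_le p hs
  rw [SatheSelberg.norm_primes_cpow_neg] at h
  exact (norm_twist_le χ p s).trans h

/-- `‖χ(p) p^{-s}‖ < 1` for `σ > 0`. -/
theorem norm_twist_lt_one (p : Nat.Primes) {s : ℂ} (hs : 0 < s.re) :
    ‖χ p * (p : ℂ) ^ (-s)‖ < 1 :=
  (norm_twist_le χ p s).trans_lt (SatheSelberg.prime_rpow_neg_lt_one p.prop hs)

/-- `1 − χ(p) p^{-s}` lies in the slit plane for `σ > 0`. -/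
theorem one_sub_twist_mem_slitPlane (p : Nat.Primes) {s : ℂ} (hs : 0 < s.re) :
    1 - χ p * (p : ℂ) ^ (-s) ∈ slitPlane := by
  rw [mem_slitPlane_iff]
  left
  have h1 := re_le_norm (χ p * (p : ℂ) ^ (-s))
  have h2 := norm_twist_lt_one χ p hs
  simp only [sub_re, one_re]
  linarith

/-! ### The factors `E(w_p, z)`: holomorphy and locally uniform convergence of `G` -/

/-- Each factor `E(w_p(s), z)` is holomorphic in `s` on `σ > 0`. -/
theorem differentiableAt_factor (p : Nat.Primes) (z : ℂ) {s : ℂ} (hs : 0 < s.re) :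
    DifferentiableAt ℂ (fun s : ℂ ↦ (1 + z * (χ p * (p : ℂ) ^ (-s)) +
      z ^ 2 * (χ p * (p : ℂ) ^ (-s)) ^ 2 / (1 - χ p * (p : ℂ) ^ (-s))) *
        exp (z * log (1 - χ p * (p : ℂ) ^ (-s)))) s := by
  have hq : DifferentiableAt ℂ (fun w : ℂ ↦ χ p * (p : ℂ) ^ (-w)) s :=
    (differentiableAt_id.neg.const_cpow (Or.inl (by exact_mod_cast p.prop.ne_zero))).const_mul _
  have h1q : DifferentiableAt ℂ (fun w : ℂ ↦ 1 - χ p * (p : ℂ) ^ (-w)) s :=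
    (differentiableAt_const _).sub hq
  have hne : (1 : ℂ) - χ p * (p : ℂ) ^ (-s) ≠ 0 :=
    slitPlane_ne_zero (one_sub_twist_mem_slitPlane χ p hs)
  have hlog : DifferentiableAt ℂ (fun w : ℂ ↦ log (1 - χ p * (p : ℂ) ^ (-w))) s :=
    h1q.clog (one_sub_twist_mem_slitPlane χ p hs)
  exact ((((differentiableAt_const _).add ((differentiableAt_const _).mul hq)).add
    (((differentiableAt_const _).mul (hq.pow 2)).div h1q hne)).mul
      ((differentiableAt_const _).mul hlog).cexp)

/-- **Locally uniform convergence of `G(s) = ∏_p E(w_p(s), z)` on `σ > σ₀ > 1/2`** (every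
`z`): eventually in `p` the quadratic closeness gives `‖E − 1‖ ≤ 20(|z| + |z|²) p^{-2σ₀}`
uniformly on `σ ≥ σ₀`, a summable majorant. -/
theorem hasProdLocallyUniformlyOn_factor (z : ℂ) {σ₀ : ℝ} (hσ₀ : 1 / 2 < σ₀) :
    HasProdLocallyUniformlyOn
      (fun (p : Nat.Primes) (s : ℂ) ↦ (1 + z * (χ p * (p : ℂ) ^ (-s)) +
        z ^ 2 * (χ p * (p : ℂ) ^ (-s)) ^ 2 / (1 - χ p * (p : ℂ) ^ (-s))) *
          exp (z * log (1 - χ p * (p : ℂ) ^ (-s))))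
      (fun s ↦ ∏' p : Nat.Primes, (1 + z * (χ p * (p : ℂ) ^ (-s)) +
        z ^ 2 * (χ p * (p : ℂ) ^ (-s)) ^ 2 / (1 - χ p * (p : ℂ) ^ (-s))) *
          exp (z * log (1 - χ p * (p : ℂ) ^ (-s))))
      {s : ℂ | σ₀ < s.re} := by
  set E : Nat.Primes → ℂ → ℂ := fun p s ↦ (1 + z * (χ p * (p : ℂ) ^ (-s)) +
    z ^ 2 * (χ p * (p : ℂ) ^ (-s)) ^ 2 / (1 - χ p * (p : ℂ) ^ (-s))) *
      exp (z * log (1 - χ p * (p : ℂ) ^ (-s))) with hE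
  have hK : IsOpen {s : ℂ | σ₀ < s.re} := isOpen_lt continuous_const continuous_re
  have hu : Summable fun p : Nat.Primes ↦
      20 * (‖z‖ + ‖z‖ ^ 2) * ((p : ℕ) : ℝ) ^ (-(2 * σ₀)) :=
    ((Nat.Primes.summable_rpow (r := -(2 * σ₀))).2 (by linarith)).mul_left _
  -- the quadratic bound, eventually in `p`, uniformly on `σ ≥ σ₀`
  have hev : ∀ᶠ p : Nat.Primes in cofinite, ∀ s ∈ {s : ℂ | σ₀ < s.re},
      ‖E p s - 1‖ ≤ 20 * (‖z‖ + ‖z‖ ^ 2) * ((p : ℕ) : ℝ) ^ (-(2 * σ₀)) := by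
    have hδ : (0 : ℝ) < 1 / (4 * (‖z‖ + 1)) := by positivity
    filter_upwards [(SatheSelberg.tendsto_primes_rpow_neg (by linarith : 0 < σ₀)).eventually
      (Iio_mem_nhds hδ)] with p hp s hs
    have hs' : σ₀ ≤ s.re := le_of_lt hs
    have hp1 : (1 : ℝ) ≤ ((p : ℕ) : ℝ) := by exact_mod_cast p.prop.one_lt.le
    have hmono : ((p : ℕ) : ℝ) ^ (-s.re) ≤ ((p : ℕ) : ℝ) ^ (-σ₀) :=
      Real.rpow_le_rpow_of_exponent_le hp1 (by linarith)
    have hw := norm_twist_le χ p s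
    have hzq : ‖z‖ * ‖χ p * (p : ℂ) ^ (-s)‖ ≤ 1 / 4 := by
      calc ‖z‖ * ‖χ p * (p : ℂ) ^ (-s)‖ ≤ ‖z‖ * (1 / (4 * (‖z‖ + 1))) :=
            mul_le_mul_of_nonneg_left ((hw.trans hmono).trans (Set.mem_Iio.1 hp).le)
              (norm_nonneg _)
        _ ≤ 1 / 4 := by
            rw [mul_one_div, div_le_div_iff₀ (by positivity) (by norm_num)]
            nlinarith [norm_nonneg z]
    refine (norm_capFactor_sub_one_le
      (norm_twist_le_three_div_four χ p (by linarith)) hzq).trans ?_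
    have h2 : ‖χ p * (p : ℂ) ^ (-s)‖ ^ 2 ≤ ((p : ℕ) : ℝ) ^ (-(2 * σ₀)) := by
      refine (pow_le_pow_left₀ (norm_nonneg _) hw 2).trans ?_
      rw [← Real.rpow_natCast, ← Real.rpow_mul (Nat.cast_nonneg _)]
      exact Real.rpow_le_rpow_of_exponent_le hp1 (by push_cast; linarith)
    gcongr
  have hcts : ∀ p : Nat.Primes, ContinuousOn (fun s ↦ E p s - 1) {s : ℂ | σ₀ < s.re} :=
    fun p s hs ↦ ((differentiableAt_factor χ p z
      (by simp only [Set.mem_setOf_eq] at hs; linarith)).continuousAt.sub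
        continuousAt_const).continuousWithinAt
  have h := Summable.hasProdLocallyUniformlyOn_one_add hK hu hev hcts
  simp only [add_sub_cancel] at h
  exact h

/-- **`G` is holomorphic on `σ > 1/2`** (locally uniform limit of holomorphic finite products on
each `σ > σ₀ > 1/2`). -/
theorem differentiableOn_tprod_factor (z : ℂ) :
    DifferentiableOn ℂ (fun s ↦ ∏' p : Nat.Primes, (1 + z * (χ p * (p : ℂ) ^ (-s)) +
      z ^ 2 * (χ p * (p : ℂ) ^ (-s)) ^ 2 / (1 - χ p * (p : ℂ) ^ (-s))) *
        exp (z * log (1 - χ p * (p : ℂ) ^ (-s)))) {s : ℂ | 1 / 2 < s.re} := by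
  set E : Nat.Primes → ℂ → ℂ := fun p s ↦ (1 + z * (χ p * (p : ℂ) ^ (-s)) +
    z ^ 2 * (χ p * (p : ℂ) ^ (-s)) ^ 2 / (1 - χ p * (p : ℂ) ^ (-s))) *
      exp (z * log (1 - χ p * (p : ℂ) ^ (-s))) with hE
  intro s hs
  obtain ⟨σ₀, h1, h2⟩ := exists_between (show 1 / 2 < s.re from hs)
  have hK : IsOpen {s : ℂ | σ₀ < s.re} := isOpen_lt continuous_const continuous_re
  have hdiff : ∀ᶠ S : Finset Nat.Primes in atTop,
      DifferentiableOn ℂ (fun s ↦ ∏ p ∈ S, E p s) {s : ℂ | σ₀ < s.re} := by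
    refine Eventually.of_forall fun S ↦ ?_
    rw [← Finset.prod_fn S E]
    refine DifferentiableOn.finsetProd fun p _ w hw ↦ ?_
    exact (differentiableAt_factor χ p z (by
      simp only [Set.mem_setOf_eq] at hw; linarith)).differentiableWithinAt
  have h := TendstoLocallyUniformlyOn.differentiableOn
    (hasProdLocallyUniformlyOn_factor χ z h1) hdiff hK
  exact (h.differentiableAt (hK.mem_nhds h2)).differentiableWithinAt

/-! ### The twisted Dirichlet series: Euler product and majorants -/

/-- `term (χ · a) s n = χ(n) · term a s n`. -/
theorem term_twist (a : ℕ → ℂ) (s : ℂ) (n : ℕ) :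
    term (fun n : ℕ ↦ χ n * a n) s n = χ n * term a s n := by
  rcases eq_or_ne n 0 with rfl | hn
  · simp
  simp only [term_of_ne_zero hn, mul_div_assoc]

/-- `‖term (χ · a) s n‖ ≤ ‖term a s n‖`. -/
theorem norm_term_twist_le (a : ℕ → ℂ) (s : ℂ) (n : ℕ) :
    ‖term (fun n : ℕ ↦ χ n * a n) s n‖ ≤ ‖term a s n‖ := by
  rw [term_twist, norm_mul]
  exact mul_le_of_le_one_left (norm_nonneg _) (χ.norm_le_one _)

/-- **Absolute convergence of `Σ χ(n) z^{s(n)} n^{-s}` for `σ > 1`.** -/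
theorem summable_norm_term (z : ℂ) {s : ℂ} (hs : 1 < s.re) :
    Summable fun n ↦
      ‖term (fun n : ℕ ↦ χ n * z ^ (n.factorization.sum fun _ v => min v 2)) s n‖ :=
  (SelbergDelangeCapped.summable_norm_term z hs).of_nonneg_of_le (fun _ ↦ norm_nonneg _)
    fun n ↦ norm_term_twist_le χ _ s n

/-- The terms at prime powers: `a(p^e) (p^e)^{-s} = z^{min(e,2)} w_p^e`. -/
theorem term_prime_pow (z s : ℂ) {p : ℕ} (hp : p.Prime) (e : ℕ) :
    term (fun n : ℕ ↦ χ n * z ^ (n.factorization.sum fun _ v => min v 2)) s (p ^ e) =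
      z ^ (min e 2) * (χ p * (p : ℂ) ^ (-s)) ^ e := by
  rw [term_twist, SelbergDelangeCapped.term_prime_pow z s hp e, Nat.cast_pow, map_pow, mul_pow]
  ring

/-- The local factor at `p`: `Σ_e a(p^e) p^{-es} = 1 + z w + z² w²/(1 − w)`, `w = χ(p) p^{-s}`
(`σ > 0`). -/
theorem hasSum_term_prime_pow (z : ℂ) {s : ℂ} (hs : 0 < s.re) (p : Nat.Primes) :
    HasSum (fun e : ℕ ↦
        term (fun n : ℕ ↦ χ n * z ^ (n.factorization.sum fun _ v => min v 2)) s
          ((p : ℕ) ^ e))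
      (1 + z * (χ p * (p : ℂ) ^ (-s)) +
        z ^ 2 * (χ p * (p : ℂ) ^ (-s)) ^ 2 / (1 - χ p * (p : ℂ) ^ (-s))) := by
  set w : ℂ := χ p * (p : ℂ) ^ (-s) with hw
  have hwn : ‖w‖ < 1 := norm_twist_lt_one χ p hs
  have e3 : (fun e : ℕ ↦
      term (fun n : ℕ ↦ χ n * z ^ (n.factorization.sum fun _ v => min v 2)) s
        ((p : ℕ) ^ e)) = fun e ↦ z ^ (min e 2) * w ^ e :=
    funext fun e ↦ term_prime_pow χ z s p.prop e
  rw [e3]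
  have hgeom : HasSum (fun n : ℕ ↦ z ^ (min (n + 2) 2) * w ^ (n + 2))
      (z ^ 2 * w ^ 2 / (1 - w)) := by
    have h := (hasSum_geometric_of_norm_lt_one hwn).mul_left (z ^ 2 * w ^ 2)
    have e1 : (fun n : ℕ ↦ z ^ (min (n + 2) 2) * w ^ (n + 2)) =
        fun n ↦ z ^ 2 * w ^ 2 * w ^ n := by
      funext n; rw [show min (n + 2) 2 = 2 by omega, pow_add]; ring
    rw [e1, div_eq_mul_inv]
    exact h
  have h2 := HasSum.sum_range_add (f := fun e : ℕ ↦ z ^ (min e 2) * w ^ e) (k := 2) hgeom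
  convert h2 using 1
  simp [Finset.sum_range_succ]

/-- **The Euler product** `Σ χ(n) z^{s(n)} n^{-s} = ∏_p (1 + z w_p + z² w_p²/(1 − w_p))`
(`σ > 1`). -/
theorem hasProd_LSeries (z : ℂ) {s : ℂ} (hs : 1 < s.re) :
    HasProd (fun p : Nat.Primes ↦ 1 + z * (χ p * (p : ℂ) ^ (-s)) +
        z ^ 2 * (χ p * (p : ℂ) ^ (-s)) ^ 2 / (1 - χ p * (p : ℂ) ^ (-s)))
      (LSeries (fun n : ℕ ↦ χ n * z ^ (n.factorization.sum fun _ v => min v 2)) s) := by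
  set a : ℕ → ℂ := fun n : ℕ ↦ χ n * z ^ (n.factorization.sum fun _ v => min v 2) with ha
  have h1 : term a s 1 = 1 := by simp [ha]
  -- `a` is multiplicative (`χ` completely multiplicative, `s` additive over coprime factors)
  have hmul : ∀ {m n : ℕ}, m.Coprime n → term a s (m * n) = term a s m * term a s n := by
    intro m n hmn
    refine SatheSelberg.term_mul_of_coprime (f := a) (fun {m n} h' ↦ ?_) s hmn
    simp only [ha, Nat.cast_mul, map_mul]
    rw [Nat.factorization_mul_of_coprime h', Finsupp.sum_add_index_of_disjoint, pow_add]
    · ring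
    rw [Nat.support_factorization, Nat.support_factorization]
    exact h'.disjoint_primeFactors
  have hE := EulerProduct.eulerProduct_hasProd h1 hmul (summable_norm_term χ z hs) (term_zero _ _)
  have heq : (fun p : Nat.Primes ↦ ∑' e : ℕ, term a s ((p : ℕ) ^ e)) =
      fun p : Nat.Primes ↦ 1 + z * (χ p * (p : ℂ) ^ (-s)) +
        z ^ 2 * (χ p * (p : ℂ) ^ (-s)) ^ 2 / (1 - χ p * (p : ℂ) ^ (-s)) :=
    funext fun p ↦ (hasSum_term_prime_pow χ z (by linarith) p).tsum_eq
  rw [heq] at hE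
  exact hE

/-- **`Σ χ(n) z^{s(n)} n^{-s} = exp(z Σ_p −Log(1 − w_p)) · G(s)` for `σ > 1`.** -/
theorem LSeries_eq (z : ℂ) {s : ℂ} (hs : 1 < s.re) :
    LSeries (fun n : ℕ ↦ χ n * z ^ (n.factorization.sum fun _ v => min v 2)) s =
      exp (z * ∑' p : Nat.Primes, -log (1 - χ p * (p : ℂ) ^ (-s))) *
        ∏' p : Nat.Primes, (1 + z * (χ p * (p : ℂ) ^ (-s)) +
          z ^ 2 * (χ p * (p : ℂ) ^ (-s)) ^ 2 / (1 - χ p * (p : ℂ) ^ (-s))) *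
            exp (z * log (1 - χ p * (p : ℂ) ^ (-s))) := by
  obtain ⟨σ₀, h1, h2⟩ := exists_between (by linarith : 1 / 2 < s.re)
  have hF := (hasProdLocallyUniformlyOn_factor χ z h1).hasProd h2
  have hL : HasProd (fun p : Nat.Primes ↦ exp (z * -log (1 - χ p * (p : ℂ) ^ (-s))))
      (exp (z * ∑' p : Nat.Primes, -log (1 - χ p * (p : ℂ) ^ (-s)))) :=
    ((DirichletCharacter.summable_neg_log_one_sub_mul_prime_cpow χ hs).hasSum.mul_left z).cexp
  have hprod := hF.mul hL
  have heq : (fun p : Nat.Primes ↦ (1 + z * (χ p * (p : ℂ) ^ (-s)) +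
      z ^ 2 * (χ p * (p : ℂ) ^ (-s)) ^ 2 / (1 - χ p * (p : ℂ) ^ (-s))) *
        exp (z * log (1 - χ p * (p : ℂ) ^ (-s))) *
          exp (z * -log (1 - χ p * (p : ℂ) ^ (-s)))) =
      fun p : Nat.Primes ↦ 1 + z * (χ p * (p : ℂ) ^ (-s)) +
        z ^ 2 * (χ p * (p : ℂ) ^ (-s)) ^ 2 / (1 - χ p * (p : ℂ) ^ (-s)) := by
    funext p
    rw [mul_assoc, ← exp_add, mul_neg, add_neg_cancel, exp_zero, mul_one]
  rw [heq] at hprod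
  rw [(hasProd_LSeries χ z hs).unique hprod, mul_comm]

/-- **The explicit bound for `G`**: `‖G(s)‖ ≤ exp(30 S (1+R)^{3/2})` for `σ > 4/5`,
`‖z‖ ≤ R`, `S = Σ_p p^{-6/5}` (each factor is `≤ exp(30 (1+R)^{3/2} ‖w_p‖^{3/2})` and
`‖w_p‖^{3/2} ≤ p^{-3σ/2} ≤ p^{-6/5}`). -/
theorem norm_tprod_factor_le {s z : ℂ} {R : ℝ} (hs : 4 / 5 < s.re) (hz : ‖z‖ ≤ R) :
    ‖∏' p : Nat.Primes, (1 + z * (χ p * (p : ℂ) ^ (-s)) +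
        z ^ 2 * (χ p * (p : ℂ) ^ (-s)) ^ 2 / (1 - χ p * (p : ℂ) ^ (-s))) *
          exp (z * log (1 - χ p * (p : ℂ) ^ (-s)))‖ ≤
      Real.exp (30 * (∑' p : Nat.Primes, ((p : ℕ) : ℝ) ^ (-(6 / 5 : ℝ))) *
        (1 + R) ^ (3 / 2 : ℝ)) := by
  set E : Nat.Primes → ℂ := fun p ↦ (1 + z * (χ p * (p : ℂ) ^ (-s)) +
    z ^ 2 * (χ p * (p : ℂ) ^ (-s)) ^ 2 / (1 - χ p * (p : ℂ) ^ (-s))) *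
      exp (z * log (1 - χ p * (p : ℂ) ^ (-s))) with hE
  have hR : 0 ≤ R := (norm_nonneg z).trans hz
  have hsum : Summable fun p : Nat.Primes ↦ ((p : ℕ) : ℝ) ^ (-(6 / 5 : ℝ)) :=
    Nat.Primes.summable_rpow.2 (by norm_num)
  have h0 : ∀ p : Nat.Primes, 0 ≤ ((p : ℕ) : ℝ) ^ (-(6 / 5 : ℝ)) := fun p ↦
    Real.rpow_nonneg (Nat.cast_nonneg _) _
  set S : ℝ := ∑' p : Nat.Primes, ((p : ℕ) : ℝ) ^ (-(6 / 5 : ℝ)) with hS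
  set M : ℝ := (1 + R) ^ (3 / 2 : ℝ) with hM
  have hM0 : 0 ≤ M := Real.rpow_nonneg (by linarith) _
  have hp : ∀ p : Nat.Primes,
      ‖E p‖ ≤ Real.exp (30 * M * ((p : ℕ) : ℝ) ^ (-(6 / 5 : ℝ))) := by
    intro p
    refine (norm_capFactor_le (norm_twist_le_three_div_four χ p (by linarith)) hz).trans ?_
    rw [Real.exp_le_exp, mul_assoc]
    refine mul_le_mul_of_nonneg_left (mul_le_mul_of_nonneg_left ?_ hM0) (by norm_num)
    have hp1 : (1 : ℝ) ≤ ((p : ℕ) : ℝ) := by exact_mod_cast p.prop.one_lt.le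
    calc ‖χ p * (p : ℂ) ^ (-s)‖ ^ (3 / 2 : ℝ)
        ≤ (((p : ℕ) : ℝ) ^ (-s.re)) ^ (3 / 2 : ℝ) :=
          Real.rpow_le_rpow (norm_nonneg _) (norm_twist_le χ p s) (by norm_num)
      _ = ((p : ℕ) : ℝ) ^ (-s.re * (3 / 2 : ℝ)) :=
          (Real.rpow_mul (Nat.cast_nonneg _) _ _).symm
      _ ≤ ((p : ℕ) : ℝ) ^ (-(6 / 5 : ℝ)) :=
          Real.rpow_le_rpow_of_exponent_le hp1 (by linarith)
  obtain ⟨σ₀, h1, h2⟩ := exists_between (by linarith : 1 / 2 < s.re)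
  refine hasProd_le_of_prod_le ((hasProdLocallyUniformlyOn_factor χ z h1).hasProd h2).norm
    fun T ↦ ?_
  calc ∏ p ∈ T, ‖E p‖
      ≤ ∏ p ∈ T, Real.exp (30 * M * ((p : ℕ) : ℝ) ^ (-(6 / 5 : ℝ))) :=
        Finset.prod_le_prod (fun p _ ↦ norm_nonneg _) fun p _ ↦ hp p
    _ = Real.exp (30 * M * ∑ p ∈ T, ((p : ℕ) : ℝ) ^ (-(6 / 5 : ℝ))) := by
        rw [Finset.mul_sum, Real.exp_sum]
    _ ≤ Real.exp (30 * S * M) := by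
        rw [Real.exp_le_exp]
        have := sum_le_hasSum T (fun p _ ↦ h0 p) hsum.hasSum
        nlinarith [mul_le_mul_of_nonneg_left this hM0]

/-- **The majorant**: for `‖z‖ ≤ R` and `1 < σ ≤ 2`,
`Σ ‖χ(n) z^{s(n)} n^{-σ}‖ ≤ Σ |z|^{s(n)} n^{-σ} ≤ e^{(30 S + 1)(1+R)^{3/2}} (σ − 1)^{-R}`
(`CappedEuler.tsum_norm_term_le`). -/
theorem tsum_norm_term_le {z : ℂ} {R σ : ℝ} (hz : ‖z‖ ≤ R) (hσ : 1 < σ)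
    (hσ2 : σ ≤ 2) :
    ∑' n, ‖term (fun n : ℕ ↦ χ n * z ^ (n.factorization.sum fun _ v => min v 2)) σ n‖
      ≤
      Real.exp ((30 * (∑' p : Nat.Primes, ((p : ℕ) : ℝ) ^ (-(6 / 5 : ℝ))) + 1) *
        (1 + R) ^ (3 / 2 : ℝ)) / (σ - 1) ^ R := by
  have hσ' : 1 < (σ : ℂ).re := by simpa using hσ
  exact (Summable.tsum_le_tsum (fun n ↦ norm_term_twist_le χ _ _ n)
    (summable_norm_term χ z hσ') (SelbergDelangeCapped.summable_norm_term z hσ')).trans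
      (CappedEuler.tsum_norm_term_le hz hσ hσ2)

end ApTwistedEuler

open ApTwistedEuler in
/-- **Helper stub (the twisted capped Euler product as engine data, generic character), PROVED.**
For a Dirichlet character `χ mod q` there is `b ≥ 0` (namely `b = 30 Σ_p p^{-6/5} + 1`) such that
for every `R ≥ 0`, `‖z‖ ≤ R`, the coefficients `a(n) = χ(n) z^{s(n)}` (`s(n) = Σ_{p^v∥n} min(v,2)`)
and `G(s) = ∏_p (1 + z w_p + z² w_p²/(1 − w_p))·exp(z·Log(1 − w_p))`, `w_p = χ(p) p^{-s}`, satisfy: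
`G` is holomorphic on `σ > 1/2` with `‖G‖ ≤ B = exp(b (1+R)^{3/2})` on `σ > 4/5`; `Σ a(n) n^{-s}`
converges absolutely and equals `exp(z Σ_p −Log(1 − w_p)) G(s)` for `σ > 1`; and
`Σ ‖a(n)‖ n^{-σ} ≤ B (σ − 1)^{-R}` for `1 < σ ≤ 2`. -/
theorem stub_apTwistedEulerDataCore :
    ∀ (q : ℕ) (χ : DirichletCharacter ℂ q), ∃ b : ℝ, 0 ≤ b ∧ ∀ R : ℝ, 0 ≤ R → ∀ z : ℂ, ‖z‖ ≤ R →
      ∃ G : ℂ → ℂ, DifferentiableOn ℂ G {s : ℂ | 1 / 2 < s.re} ∧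
        (∀ s : ℂ, 4 / 5 < s.re → ‖G s‖ ≤ Real.exp (b * (1 + R) ^ (3 / 2 : ℝ))) ∧
        (∀ σ : ℝ, 1 < σ → LSeriesSummable
          (fun n : ℕ => χ (n : ZMod q) * z ^ (n.factorization.sum fun _ v => min v 2)) σ) ∧
        (∀ s : ℂ, 1 < s.re →
          LSeries (fun n : ℕ => χ (n : ZMod q) * z ^ (n.factorization.sum fun _ v => min v 2)) s =
            Complex.exp (z * ∑' p : Nat.Primes,
              -Complex.log (1 - χ ((p : ℕ) : ZMod q) * ((p : ℕ) : ℂ) ^ (-s))) * G s) ∧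
        (∀ σ : ℝ, 1 < σ → σ ≤ 2 →
          ∑' n : ℕ, ‖LSeries.term
            (fun n : ℕ => χ (n : ZMod q) * z ^ (n.factorization.sum fun _ v => min v 2)) σ n‖ ≤
            Real.exp (b * (1 + R) ^ (3 / 2 : ℝ)) / (σ - 1) ^ R) := by
  intro q χ
  set S : ℝ := ∑' p : Nat.Primes, ((p : ℕ) : ℝ) ^ (-(6 / 5 : ℝ)) with hS
  have hS0 : 0 ≤ S := tsum_nonneg fun p ↦ Real.rpow_nonneg (Nat.cast_nonneg _) _
  refine ⟨30 * S + 1, by positivity, fun R hR z hz ↦ ⟨fun s ↦ ∏' p : Nat.Primes,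
    (1 + z * (χ p * (p : ℂ) ^ (-s)) + z ^ 2 * (χ p * (p : ℂ) ^ (-s)) ^ 2 /
      (1 - χ p * (p : ℂ) ^ (-s))) * exp (z * log (1 - χ p * (p : ℂ) ^ (-s))),
    differentiableOn_tprod_factor χ z, fun s hs ↦ ?_,
    fun σ hσ ↦ (summable_norm_term χ z (by simpa using hσ)).of_norm, fun s hs ↦ LSeries_eq χ z hs,
    fun σ hσ hσ2 ↦ tsum_norm_term_le χ hz hσ hσ2⟩⟩
  refine (norm_tprod_factor_le χ hs hz).trans (Real.exp_le_exp.2 ?_)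
  have hM0 : 0 ≤ (1 + R) ^ (3 / 2 : ℝ) := Real.rpow_nonneg (by linarith) _
  nlinarith

end Summit.Parity.BatemanHorn.Cruxes.SystemZeroRepulsion.NearFar
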